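import Mathlib
import HarnessLib.Audit
import Summits.PneNP.PneNP.Theorems.PstarChordBridgeForcing

/-!
# Pairwise killability and direction collapse for a terminal core (ROUND-24, memo §9 R4–R5, G2′; GAPTWO-PLAN S4)

FRONTIER range-avoidance ladder, rung F-N3, ROUND 24 (cell `pnp-ideate`, planner memo `r24/CORE-BOUND-NOTES.md` §7 G2′ ("any two chords of a
core are simultaneously killable somewhere … this collapses all direction classes to one"), §9 R4/R5; restricted-model proof complexity — nothing
here bears on `P` versus `NP`).

For the chord system `PstarChordBridge.sys I B` of a terminal core (bridge data `B`, chords `N`, fundamental sets `D e`):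

* `killable_pair_or_exc` — **R4 for an actual core**: two distinct chords `e ≠ e'` of `N` are killable at a common base point
  (`u_e(a) = u_{e'}(a) = 0`), unless their fundamental AND-sums form an ELLIPTIC BUNDLE, `Q_{D e'} = Q_{D e} + ν₁ν₂ + κ` with `ν₁, ν₂` affine
  (`PstarChordForcing.zeros_meet` on the rank-`≥ 4` sums `PstarChordBridgeForcing.rank_four_of_wf`; the other exception of `zeros_meet`,
  `Q_{D e'} = Q_{D e} + κ`, would force `D e = D e'` and then `e = e'` by `PstarChordBridgeForcing.eq_of_qform_eq / eq_of_fundamental_eq`);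
* `direction_collapse_sys` — **R5 for an actual core**: if the model is infeasible, no pendant reads a private (constant reads) and no two chords
  form an elliptic bundle, then either (U1) all read vectors of all chords lie on one line `{0, m}` of `𝔽₂²` (after the `GL₂` basis change
  `m ↦ (1,0)` of the two constraints the core is single-read), or (U2) exactly one chord is read, with two independent read vectors.

The bundle-freeness hypothesis is the (EXC) sub-case the memo leaves open (prover-2 g16 residue (ii): "two chords in case EQ/EXC w.r.t. the same
elliptic rank-4 form"); everything else in R4/R5 is now a theorem about instances.
-/

set_option linter.dupNamespace false -- `Summit.PneNP.PneNP.…`: summit = sub-problem name (D-0017 single-conjunct layout)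

open Finset Module Literature.Computability.Complexity
open Summit.PneNP.PneNP.Theorems.PstarTyped (Typed)
open Summit.PneNP.PneNP.Theorems.PstarSALevel (varSet bdry BoundaryExpanding SimpleOverlap)
open Summit.PneNP.PneNP.Theorems.PstarCubeIdeals (IsAffineFn)
open Summit.PneNP.PneNP.Theorems.PstarProductRank (qform polar)
open Summit.PneNP.PneNP.Theorems.PstarReadSumset (V2)
open Summit.PneNP.PneNP.Theorems.PstarChordSystem (ChordSystem)
open Summit.PneNP.PneNP.Theorems.PstarChordForcing (zeros_meet)
open Summit.PneNP.PneNP.Theorems.PstarChordBridgeTools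
open Summit.PneNP.PneNP.Theorems.PstarChordBridge
open Summit.PneNP.PneNP.Theorems.PstarChordBridgeFundamental (eq_of_fundamental_eq)
open Summit.PneNP.PneNP.Theorems.PstarChordBridgeForcing

namespace Summit.PneNP.PneNP.Theorems.PstarChordBridgeCollapse

variable {n m : ℕ}

/-- Two chords form an ELLIPTIC BUNDLE: their fundamental AND-sums differ by a product of two affine functions plus a constant (the (EXC)
exception of rank rigidity, memo §4 "K_{2,2}/K_4 bundles"). -/
def Bundle (I : LocalMap 4 n m) (B : BridgeData n m) (e e' : Fin m) : Prop :=
  ∃ ν₁ ν₂ : (Fin n → ZMod 2) → ZMod 2, IsAffineFn ν₁ ∧ IsAffineFn ν₂ ∧ ∃ κ : ZMod 2, ∀ x,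
    qform (B.D e') (fun j => I.vars j 2) (fun j => I.vars j 3) x = qform (B.D e) (fun j => I.vars j 2) (fun j => I.vars j 3) x + ν₁ x * ν₂ x + κ

/-- **R4 — pairwise killability of the chords of a core.**  On a pure `(r,3/2)`-expanding instance with simple overlaps, two distinct chords of
well-formed bridge data with `#J₀ ≤ r` are killable at a common base point, unless they form an elliptic bundle. -/
theorem killable_pair_or_exc (I : LocalMap 4 n m) (hI : I.IsPure xorAndPred) (hS : SimpleOverlap I) {r : ℕ} (hB : BoundaryExpanding r I)
    {B : BridgeData n m} (hW : B.WF I) (hr : B.J₀.card ≤ r) {e e' : Fin m} (he : e ∈ B.N) (he' : e' ∈ B.N) (hne : e ≠ e') :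
    (∃ a, (sys I B).u e a = 0 ∧ (sys I B).u e' a = 0) ∨ Bundle I B e e' := by
  have key : ∀ s g : ZMod 2, g + s = 0 ↔ s = g := by decide
  rcases zeros_meet (qform_add' I (B.D e)) (qform_add' I (B.D e')) (rank_four_of_wf I hI hS hB hW hr he)
      (rank_four_of_wf I hI hS hB hW hr he') (gam B e) (gam B e') with ⟨a, ha, ha'⟩ | ⟨κ, hκ⟩ | hexc
  · refine Or.inl ⟨a, ?_, ?_⟩
    · rw [sys_u_eq]; exact (key _ _).2 ha
    · rw [sys_u_eq]; exact (key _ _).2 ha'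
  · -- equal sums up to a constant: same fundamental set, same chord
    exfalso
    have hDD : B.D e' = B.D e := eq_of_qform_eq I hI hS hκ
    have heD : e ∉ B.D e := fun hh => (mem_sdiff.1 (hW.hD e he hh)).2 he
    have heD' : e' ∉ B.D e := fun hh => (mem_sdiff.1 (hW.hD e he hh)).2 he'
    exact hne (eq_of_fundamental_eq I hI hS heD heD' (hW.hDeven e he) (hDD ▸ hW.hDeven e' he'))
  · exact Or.inr hexc

/-- **R5 — direction collapse for a core.**  Infeasible model, no pendant of either constraint reads a private (so the read vectors are the
constants `r e = ρ_e(0)`, `r' e = ρ'_e(0)`), and no two distinct chords form an elliptic bundle: then (U1) one line `{0, m}` contains every read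
vector, or (U2) exactly one chord is read, with two independent read vectors. -/
theorem direction_collapse_sys (I : LocalMap 4 n m) (hI : I.IsPure xorAndPred) (hS : SimpleOverlap I) {r : ℕ} (hB : BoundaryExpanding r I)
    {B : BridgeData n m} (hW : B.WF I) (hr : B.J₀.card ≤ r)
    (hun : ∀ v ∈ privs I B.N, (∀ g ∈ B.G₁, I.vars g 2 ≠ v ∧ I.vars g 3 ≠ v) ∧ ∀ g ∈ B.G₂, I.vars g 2 ≠ v ∧ I.vars g 3 ≠ v)
    (hnb : ∀ e ∈ B.N, ∀ e' ∈ B.N, e ≠ e' → ¬ Bundle I B e e') (hinf : (sys I B).Infeasible B.N) :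
    (∃ mv : V2, ∀ e ∈ B.N, ((sys I B).ρ e 0 = 0 ∨ (sys I B).ρ e 0 = mv) ∧ ((sys I B).ρ' e 0 = 0 ∨ (sys I B).ρ' e 0 = mv)) ∨
    (∃ e₀ ∈ B.N, (sys I B).ρ e₀ 0 ≠ 0 ∧ (sys I B).ρ' e₀ 0 ≠ 0 ∧ (sys I B).ρ e₀ 0 ≠ (sys I B).ρ' e₀ 0 ∧
      ∀ e ∈ B.N, e ≠ e₀ → (sys I B).ρ e 0 = 0 ∧ (sys I B).ρ' e 0 = 0) := by
  have hconst := const_of_unread I B hun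
  refine (sys I B).direction_collapse hinf (r := fun e => (sys I B).ρ e 0) (r' := fun e => (sys I B).ρ' e 0)
    (fun e a => (hconst e a 0).1) (fun e a => (hconst e a 0).2) fun e he e' he' hne => ?_
  rcases killable_pair_or_exc I hI hS hB hW hr he he' hne with h | h
  · exact h
  · exact absurd h (hnb e he e' he' hne)

/-- **The read vectors at the origin, explicitly**: with no pendant reading a private, chord `e ∈ N` is read by constraint `i` through `p_e`
iff `p_e ∈ Cᵢ` (linear reads only). -/
theorem ρ_zero_of_unread (I : LocalMap 4 n m) (B : BridgeData n m)
    (hun : ∀ v ∈ privs I B.N, (∀ g ∈ B.G₁, I.vars g 2 ≠ v ∧ I.vars g 3 ≠ v) ∧ ∀ g ∈ B.G₂, I.vars g 2 ≠ v ∧ I.vars g 3 ≠ v)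
    {e : Fin m} (he : e ∈ B.N) :
    (sys I B).ρ e 0 = ((if I.vars e 2 ∈ B.C₁ then 1 else 0), (if I.vars e 2 ∈ B.C₂ then 1 else 0)) ∧
    (sys I B).ρ' e 0 = ((if I.vars e 3 ∈ B.C₁ then 1 else 0), (if I.vars e 3 ∈ B.C₂ then 1 else 0)) := by
  have h2 := hun _ (vars_mem_privs I he (s := 2) (by decide))
  have h3 := hun _ (vars_mem_privs I he (s := 3) (by decide))
  rw [sys_ρ I B he, sys_ρ' I B he, coef_of_unread I h2.1, coef_of_unread I h2.2, coef_of_unread I h3.1, coef_of_unread I h3.2]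
  exact ⟨rfl, rfl⟩

end Summit.PneNP.PneNP.Theorems.PstarChordBridgeCollapse
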